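import Literature.NumberTheory.LFunctions.Zhang2022.RepairSection9Theta
import Literature.NumberTheory.LFunctions.Zhang2022.RepairSection18Theta

/-!
# Zhang (2022) §§8–9 at a design `θ`: `𝔠₁(θ)`, `𝔠₂(θ)` and the full margin functional `C₂₃₂(θ)`

Trunk T-ANT (NumberTheory/LFunctions). Companion of `RepairSection9Theta.lean` (the mollifier-pair block
`pairForm k_L k_S ν_L ν_S u_L u_S` with RATIONAL shift multipliers, closed forms and boxes downstream),
`RepairTheta.lean` (the design record `Repair.Theta` of record — REAL coordinates `ν₁ ν₂ ν₃ k₁ k₂ k₃`, `ι₂ ι₃ ι₄`,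
`cut₁` — and the real-parameter profiles `ffT`, `ghT`) and `RepairSection18Theta.lean` (`𝔠₃(θ)` and the
assembly `C232T θ c₁ c₂`, `Margin232T θ c₁ c₂` taking the two feeder values as arguments), all for Y. Zhang,
*Discrete mean estimates and the Landau–Siegel zero*, arXiv:2211.02515v1 [Zhang2022LandauSiegel] — **an
unrefereed manuscript under adjudication; nothing here asserts any of its claims.**

**Content.** The two feeder values as functionals of the design record, so that the §18 margin becomes ONE
functional of `θ`:
* `pairFormR (k_L k_S ν_L ν_S : ℝ) (u_L u_S : ℂ)` — the pair form over REAL shift multipliers, built on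
  `Repair.ffT/ghT` (integral form, displays (8.19)–(8.23)/(9.3)–(9.7)); `pairFormR_ratCast`: at rational
  `k_L, k_S` it IS `pairForm` (so every closed form / kernel box of `RepairSection9Theta`,
  `RepairSection9Boxes`, `RepairSection9ThetaCert` applies); bridges `ffT_ratCast'`, `ghT_ratCast_one/two/three`.
* `frakc1T θ = pairFormR k₁ k₂ ν₁ ν₂ 1 ι₂` ((8.23): `H₁ = H₁₁ + ι₂H₁₂`), `frakc2T θ = pairFormR k₂ k₃ ν₂ ν₃ ῑ₄ ῑ₃`
  ((9.7): `H₂ = ῑ₃H₁₃ + ῑ₄H₁₂`, DERIVED prefactor `1/(ν₂ν₃π)` of (9.5)–(9.6) — the reading of record, lead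
  ruling R2), and `frakc2PT θ` (the PRINTED-prefactor reading continued as `1/(ν₁ν₃π)`, i.e. cross entries
  scaled by `ν₂/ν₁`; reported, never certifying).
* Regression: `frakc1T_theta0 : frakc1T θ₀ = 𝔠₁`, `frakc2T_theta0 : frakc2T θ₀ = 𝔠₂ᶜ`,
  `frakc2PT_theta0 : frakc2PT θ₀ = 𝔠₂`; on the `ι`-family `frakc1T (thetaIota w) = frakc1G w₂`,
  `frakc2T (thetaIota w) = frakc2cG w₃ w₄`, `frakc2PT (thetaIota w) = frakc2G w₃ w₄` (`Section18AllIota`).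
* The full functionals `C232D θ := C232T θ (frakc1T θ) (frakc2T θ)` (derived reading) and
  `C232P θ := C232T θ (frakc1T θ) (frakc2PT θ)` (printed reading), `Margin232D/P`; regressions
  `C232D_theta0 = C232c`, `C232P_theta0 = C232`, `margin232P_theta0_iff : Margin232P θ₀ ↔ Skeleton.Margin232`,
  `not_margin232P_theta0`, and on the `ι`-family `C232D (thetaIota w) = C232cG w`, `C232P (thetaIota w) = C232G w`
  with the transported floors `0.02491 ≤ C232D`, `0.03095 ≤ C232P` (`Section18AllIota`).

What is NOT here: closed forms / boxes at real (irrational) `k` (certify at rational `k` via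
`pairFormR_ratCast`), any admissibility condition on `θ`, and any statement about Theorems 1–2.
-/

noncomputable section

open Complex Real ComplexConjugate

namespace Literature.NumberTheory.LFunctions.Zhang2022

namespace Repair

/-! ### The pair block over real shift multipliers (profiles `ffT`, `ghT` of `RepairTheta`) -/

/-- the weighted diagonal integrand `Σ_j w_j 𝔣𝔣_{j}(z)𝔤𝔥_{j}(z)` at real shift multiplier `k`.
[cite: Zhang2022LandauSiegel, (8.19)–(8.20) p.49, (9.3) p.51] -/
def diagIntegrandR (k : ℝ) (z : ℝ) : ℂ :=
  1/2 * (ffT k 1 z * ghT k 1 z) + 2 * (ffT k 2 z * ghT k 2 z) + 3/2 * (ffT k 3 z * ghT k 3 z)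

/-- the weighted cross integrand `Σ_j w_j 𝔣𝔣_{jL}(z + s)𝔤𝔥_{jS}(z)` at real shift multipliers.
[cite: Zhang2022LandauSiegel, (8.22) p.49, (9.5) p.51] -/
def crossYIntegrandR (kL kS : ℝ) (s z : ℝ) : ℂ :=
  1/2 * (ffT kL 1 (z + s) * ghT kS 1 z) + 2 * (ffT kL 2 (z + s) * ghT kS 2 z)
    + 3/2 * (ffT kL 3 (z + s) * ghT kS 3 z)

/-- the weighted cross integrand `Σ_j w_j 𝔣𝔣_{jS}(z)𝔤𝔥_{jL}(z + s)` at real shift multipliers.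
[cite: Zhang2022LandauSiegel, (8.21) p.49, (9.6) p.52] -/
def crossXIntegrandR (kL kS : ℝ) (s z : ℝ) : ℂ :=
  1/2 * (ffT kS 1 z * ghT kL 1 (z + s)) + 2 * (ffT kS 2 z * ghT kL 2 (z + s))
    + 3/2 * (ffT kS 3 z * ghT kL 3 (z + s))

/-- `b_μμ(k, ν) = (ν²π)⁻¹∫₀^ν Σ_j w_j 𝔣𝔣_j 𝔤𝔥_j` at real `k`. [cite: Zhang2022LandauSiegel, (8.19)–(8.20) p.49, (9.3) p.51] -/
def bDiagR (k ν : ℝ) : ℂ := ((1 / (ν ^ 2 * π) : ℝ) : ℂ) * ∫ z in (0:ℝ)..ν, diagIntegrandR k z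

/-- `b_Y(k_L,k_S,ν_L,ν_S)` at real `k`. [cite: Zhang2022LandauSiegel, (8.22) p.49, (9.5) p.51] -/
def bCrossYR (kL kS νL νS : ℝ) : ℂ :=
  ((1 / (νL * νS * π) : ℝ) : ℂ) * ∫ z in (0:ℝ)..νS, crossYIntegrandR kL kS (νL - νS) z

/-- `b_X(k_L,k_S,ν_L,ν_S)` at real `k`. [cite: Zhang2022LandauSiegel, (8.21) p.49, (9.6) p.52] -/
def bCrossXR (kL kS νL νS : ℝ) : ℂ :=
  ((1 / (νL * νS * π) : ℝ) : ℂ) * ∫ z in (0:ℝ)..νS, crossXIntegrandR kL kS (νL - νS) z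

/-- `c_μμ = b_μμ + b̄_μμ` at real `k`. [cite: Zhang2022LandauSiegel, §8 after (8.23) p.50] -/
def cDiagR (k ν : ℝ) : ℂ := bDiagR k ν + conj (bDiagR k ν)

/-- `c_LS = b_Y + b̄_X` at real `k`. [cite: Zhang2022LandauSiegel, §8 after (8.23) p.50] -/
def cCrossR (kL kS νL νS : ℝ) : ℂ := bCrossYR kL kS νL νS + conj (bCrossXR kL kS νL νS)

/-- **the Hermitian pair form at a real design** `|u_L|²c_LL + u_Lū_Sc_LS + ū_Lu_Sc̄_LS + |u_S|²c_SS`.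
[cite: Zhang2022LandauSiegel, (8.23) p.50, (9.7) p.52] -/
def pairFormR (kL kS νL νS : ℝ) (uL uS : ℂ) : ℂ :=
  (Complex.normSq uL : ℂ) * cDiagR kL νL + uL * conj uS * cCrossR kL kS νL νS
    + conj uL * uS * conj (cCrossR kL kS νL νS) + (Complex.normSq uS : ℂ) * cDiagR kS νS

/-! ### Bridges to the rational-multiplier block of `RepairSection9Theta` -/

/-- `ffT` at a rational multiplier is `ffMain`. [cite: Zhang2022LandauSiegel, (8.13)–(8.18) p.49] -/
theorem ffT_ratCast' (k : ℚ) (j : ℕ) : ffT (k : ℝ) j = ffMain k j := by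
  rw [ffMain, ← ffR_ratCast]; unfold ffT; congr 1; push_cast; ring

/-- `ghT k 1 = ghMain k 2 3` at rational `k` (`N₁ = 2·3`, `S₁ = 2 + 3`). [cite: Zhang2022LandauSiegel, (8.13), (8.16) p.49] -/
theorem ghT_ratCast_one (k : ℚ) : ghT (k : ℝ) 1 = ghMain k 2 3 := by
  rw [ghMain, ← ghR_ratCast]; unfold ghT r0Main bMain; rw [bN_one, bS_one]
  congr 1 <;> push_cast <;> ring

/-- `ghT k 2 = ghMain k 3 1` at rational `k`. [cite: Zhang2022LandauSiegel, (8.14), (8.17) p.49] -/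
theorem ghT_ratCast_two (k : ℚ) : ghT (k : ℝ) 2 = ghMain k 3 1 := by
  rw [ghMain, ← ghR_ratCast]; unfold ghT r0Main bMain; rw [bN_two, bS_two]
  congr 1 <;> push_cast <;> ring

/-- `ghT k 3 = ghMain k 1 2` at rational `k`. [cite: Zhang2022LandauSiegel, (8.15), (8.18) p.49] -/
theorem ghT_ratCast_three (k : ℚ) : ghT (k : ℝ) 3 = ghMain k 1 2 := by
  rw [ghMain, ← ghR_ratCast]; unfold ghT r0Main bMain; rw [bN_three, bS_three]
  congr 1 <;> push_cast <;> ring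

/-- `diagIntegrandR` at rational `k` is `diagIntegrand`. [cite: Zhang2022LandauSiegel, (8.19) p.49] -/
theorem diagIntegrandR_ratCast (k : ℚ) : diagIntegrandR (k : ℝ) = diagIntegrand k := by
  funext z
  simp only [diagIntegrandR, diagIntegrand, ffT_ratCast', ghT_ratCast_one, ghT_ratCast_two, ghT_ratCast_three,
    Nat.cast_one, Nat.cast_ofNat]

/-- `crossYIntegrandR` at rational `k_L, k_S` is `crossYIntegrand`. [cite: Zhang2022LandauSiegel, (8.22) p.49] -/
theorem crossYIntegrandR_ratCast (kL kS : ℚ) : crossYIntegrandR (kL : ℝ) (kS : ℝ) = crossYIntegrand kL kS := by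
  funext s z
  simp only [crossYIntegrandR, crossYIntegrand, ffT_ratCast', ghT_ratCast_one, ghT_ratCast_two,
    ghT_ratCast_three, Nat.cast_one, Nat.cast_ofNat]

/-- `crossXIntegrandR` at rational `k_L, k_S` is `crossXIntegrand`. [cite: Zhang2022LandauSiegel, (8.21) p.49] -/
theorem crossXIntegrandR_ratCast (kL kS : ℚ) : crossXIntegrandR (kL : ℝ) (kS : ℝ) = crossXIntegrand kL kS := by
  funext s z
  simp only [crossXIntegrandR, crossXIntegrand, ffT_ratCast', ghT_ratCast_one, ghT_ratCast_two,
    ghT_ratCast_three, Nat.cast_one, Nat.cast_ofNat]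

/-- `bDiagR (k : ℚ) = bDiag k`. [cite: Zhang2022LandauSiegel, (8.19)–(8.20) p.49, (9.3) p.51] -/
theorem bDiagR_ratCast (k : ℚ) (ν : ℝ) : bDiagR (k : ℝ) ν = bDiag k ν := by
  unfold bDiagR bDiag; rw [diagIntegrandR_ratCast]

/-- `bCrossYR (k_L k_S : ℚ) = bCrossY k_L k_S`. [cite: Zhang2022LandauSiegel, (8.22) p.49, (9.5) p.51] -/
theorem bCrossYR_ratCast (kL kS : ℚ) (νL νS : ℝ) : bCrossYR (kL : ℝ) (kS : ℝ) νL νS = bCrossY kL kS νL νS := by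
  unfold bCrossYR bCrossY; rw [crossYIntegrandR_ratCast]

/-- `bCrossXR (k_L k_S : ℚ) = bCrossX k_L k_S`. [cite: Zhang2022LandauSiegel, (8.21) p.49, (9.6) p.52] -/
theorem bCrossXR_ratCast (kL kS : ℚ) (νL νS : ℝ) : bCrossXR (kL : ℝ) (kS : ℝ) νL νS = bCrossX kL kS νL νS := by
  unfold bCrossXR bCrossX; rw [crossXIntegrandR_ratCast]

/-- `cDiagR (k : ℚ) = cDiag k`. [cite: Zhang2022LandauSiegel, §8 after (8.23) p.50] -/
theorem cDiagR_ratCast (k : ℚ) (ν : ℝ) : cDiagR (k : ℝ) ν = cDiag k ν := by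
  unfold cDiagR cDiag; rw [bDiagR_ratCast]

/-- `cCrossR (k_L k_S : ℚ) = cCross k_L k_S`. [cite: Zhang2022LandauSiegel, §8 after (8.23) p.50] -/
theorem cCrossR_ratCast (kL kS : ℚ) (νL νS : ℝ) : cCrossR (kL : ℝ) (kS : ℝ) νL νS = cCross kL kS νL νS := by
  unfold cCrossR cCross; rw [bCrossYR_ratCast, bCrossXR_ratCast]

/-- **at rational shift multipliers the real-design pair form IS the block of `RepairSection9Theta`**
(so its closed forms and kernel boxes apply verbatim). [cite: Zhang2022LandauSiegel, (8.23) p.50, (9.7) p.52] -/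
theorem pairFormR_ratCast (kL kS : ℚ) (νL νS : ℝ) (uL uS : ℂ) :
    pairFormR (kL : ℝ) (kS : ℝ) νL νS uL uS = pairForm kL kS νL νS uL uS := by
  unfold pairFormR pairForm; rw [cDiagR_ratCast, cDiagR_ratCast, cCrossR_ratCast]

/-! ### The feeder values at a design `θ` -/

/-- **`𝔠₁(θ)`** = the pair form of `H₁ = H₁₁ + ι₂H₁₂` (8.23): longer component `(ν₁, k₁)` with coefficient
`1`, shorter `(ν₂, k₂)` with coefficient `ι₂`. [cite: Zhang2022LandauSiegel, (8.23) p.50] -/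
def frakc1T (θ : Theta) : ℂ := pairFormR θ.k1 θ.k2 θ.nu1 θ.nu2 1 θ.iota2

/-- **`𝔠₂(θ)`, DERIVED prefactor** = the pair form of `H₂ = ῑ₃H₁₃ + ῑ₄H₁₂` (9.2), (9.7): longer component
`(ν₂, k₂)` with coefficient `ῑ₄`, shorter `(ν₃, k₃)` with coefficient `ῑ₃`; cross prefactor `1/(ν₂ν₃π)`
(the reading that the substitution `x = Pᶻ` produces; at `θ₀` this is `Section18Defs.frakc2c`).
[cite: Zhang2022LandauSiegel, (9.7) p.52] -/
def frakc2T (θ : Theta) : ℂ := pairFormR θ.k2 θ.k3 θ.nu2 θ.nu3 (conj θ.iota4) (conj θ.iota3)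

/-- `𝔠₂(θ)` in the PRINTED-prefactor reading continued off `θ₀` as `1/(ν₁ν₃π)` in (9.5)–(9.6): the cross
entries of `frakc2T` scaled by `ν₂/ν₁` (at `θ₀`: `125/126`, `Section18Defs.frakc2`). Reported alongside
`frakc2T`; it is produced by no derivation step (ruling R2 of the repair rung). [cite: Zhang2022LandauSiegel, (9.5)–(9.7) p.51–52] -/
def frakc2PT (θ : Theta) : ℂ :=
  (Complex.normSq (conj θ.iota4) : ℂ) * cDiagR θ.k2 θ.nu2
    + conj θ.iota4 * conj (conj θ.iota3) * (((θ.nu2 / θ.nu1 : ℝ) : ℂ) * cCrossR θ.k2 θ.k3 θ.nu2 θ.nu3)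
    + conj (conj θ.iota4) * conj θ.iota3 * conj (((θ.nu2 / θ.nu1 : ℝ) : ℂ) * cCrossR θ.k2 θ.k3 θ.nu2 θ.nu3)
    + (Complex.normSq (conj θ.iota3) : ℂ) * cDiagR θ.k3 θ.nu3

/-! ### Regression at the printed design and on the `ι`-family -/

/-- `𝔠₁` on the `ι`-family is `Section18AllIota.frakc1G`. [cite: Zhang2022LandauSiegel, (8.23) p.50] -/
theorem frakc1T_thetaIota (w2 w3 w4 : ℂ) : frakc1T (thetaIota w2 w3 w4) = frakc1G w2 := by
  unfold frakc1T frakc1G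
  simp only [thetaIota_k1, thetaIota_k2, thetaIota_nu1, thetaIota_nu2, thetaIota_iota2]
  have e : pairFormR (3 / 2) (5 / 2) 0.504 0.5 1 w2 = pairFormR ((3/2 : ℚ) : ℝ) ((5/2 : ℚ) : ℝ) 0.504 0.5 1 w2 := by
    norm_num
  rw [e, pairFormR_ratCast]
  unfold pairForm c21
  rw [c11_eq_cDiag, c22_eq_cDiag, c12_eq_cCross]
  simp only [map_one, Complex.ofReal_one, one_mul]
  ring

/-- `𝔠₂` (derived prefactor) on the `ι`-family is `Section18AllIota.frakc2cG`. [cite: Zhang2022LandauSiegel, (9.7) p.52] -/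
theorem frakc2T_thetaIota (w2 w3 w4 : ℂ) : frakc2T (thetaIota w2 w3 w4) = frakc2cG w3 w4 := by
  unfold frakc2T frakc2cG c43c
  simp only [thetaIota_k2, thetaIota_k3, thetaIota_nu2, thetaIota_nu3, thetaIota_iota3, thetaIota_iota4]
  have e : pairFormR (5 / 2) (3 / 2) 0.5 0.498 (conj w4) (conj w3)
      = pairFormR ((5/2 : ℚ) : ℝ) ((3/2 : ℚ) : ℝ) 0.5 0.498 (conj w4) (conj w3) := by norm_num
  rw [e, pairFormR_ratCast]
  unfold pairForm
  rw [c33_eq_cDiag, c44_eq_cDiag, c34c_eq_cCross]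
  simp only [Complex.conj_conj, Complex.normSq_conj]
  ring

/-- `𝔠₂` (printed prefactor) on the `ι`-family is `Section18AllIota.frakc2G`. [cite: Zhang2022LandauSiegel, (9.7) p.52] -/
theorem frakc2PT_thetaIota (w2 w3 w4 : ℂ) : frakc2PT (thetaIota w2 w3 w4) = frakc2G w3 w4 := by
  unfold frakc2PT frakc2G c43
  simp only [thetaIota_k2, thetaIota_k3, thetaIota_nu1, thetaIota_nu2, thetaIota_nu3, thetaIota_iota3,
    thetaIota_iota4]
  have e1 : cDiagR (5 / 2) 0.5 = cDiagR ((5/2 : ℚ) : ℝ) 0.5 := by norm_num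
  have e2 : cDiagR (3 / 2) 0.498 = cDiagR ((3/2 : ℚ) : ℝ) 0.498 := by norm_num
  have e3 : cCrossR (5 / 2) (3 / 2) 0.5 0.498 = cCrossR ((5/2 : ℚ) : ℝ) ((3/2 : ℚ) : ℝ) 0.5 0.498 := by norm_num
  have e4 : (((0.5 : ℝ) / 0.504 : ℝ) : ℂ) = ((125 / 126 : ℝ) : ℂ) := by norm_num
  rw [e1, e2, e3, e4, cDiagR_ratCast, cDiagR_ratCast, cCrossR_ratCast, c33_eq_cDiag, c44_eq_cDiag,
    c34_eq_smul_c34c, c34c_eq_cCross]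
  simp only [Complex.conj_conj, Complex.normSq_conj]
  ring

/-- **regression**: `𝔠₁(θ₀) = 𝔠₁`. [cite: Zhang2022LandauSiegel, (8.23) p.50] -/
theorem frakc1T_theta0 : frakc1T theta0 = frakc1 := by
  rw [← thetaIota_iota, frakc1T_thetaIota, frakc1G_iota]

/-- **regression**: `𝔠₂(θ₀) = 𝔠₂ᶜ` (derived prefactor). [cite: Zhang2022LandauSiegel, (9.7) p.52] -/
theorem frakc2T_theta0 : frakc2T theta0 = frakc2c := by
  rw [← thetaIota_iota, frakc2T_thetaIota, frakc2cG_iota]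

/-- **regression**: `frakc2PT θ₀ = 𝔠₂` (printed prefactor). [cite: Zhang2022LandauSiegel, (9.7) p.52] -/
theorem frakc2PT_theta0 : frakc2PT theta0 = frakc2 := by
  rw [← thetaIota_iota, frakc2PT_thetaIota, frakc2G_iota]

/-! ### The full margin functionals of `θ` -/

/-- **`C₂₃₂(θ)`, reading of record** (derived prefactor): `Re 𝔠₁(θ) + Re 𝔠₂(θ) + 2Re 𝔠₃ʳ(θ)`.
[cite: Zhang2022LandauSiegel, (2.32) p.11, §18 p.99] -/
def C232D (θ : Theta) : ℝ := C232T θ (frakc1T θ) (frakc2T θ)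

/-- `C₂₃₂(θ)` with the printed-prefactor `𝔠₂` (reported reading). [cite: Zhang2022LandauSiegel, (2.32) p.11, §18 p.99] -/
def C232P (θ : Theta) : ℝ := C232T θ (frakc1T θ) (frakc2PT θ)

/-- **the printed §18 margin as ONE functional of `θ`**, reading of record. [cite: Zhang2022LandauSiegel, §18 p.99] -/
def Margin232D (θ : Theta) : Prop := Margin232T θ (frakc1T θ) (frakc2T θ)

/-- the printed §18 margin as a functional of `θ`, printed-prefactor reading (the object whose value at `θ₀` is
`Skeleton.Margin232`). [cite: Zhang2022LandauSiegel, §18 p.99] -/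
def Margin232P (θ : Theta) : Prop := Margin232T θ (frakc1T θ) (frakc2PT θ)

/-- `C232D` on the `ι`-family is `C232cG`. [cite: Zhang2022LandauSiegel, (2.32) p.11] -/
theorem C232D_thetaIota (w2 w3 w4 : ℂ) : C232D (thetaIota w2 w3 w4) = C232cG w2 w3 w4 := by
  unfold C232D; rw [frakc1T_thetaIota, frakc2T_thetaIota, C232T_thetaIota_c]

/-- `C232P` on the `ι`-family is `C232G`. [cite: Zhang2022LandauSiegel, (2.32) p.11] -/
theorem C232P_thetaIota (w2 w3 w4 : ℂ) : C232P (thetaIota w2 w3 w4) = C232G w2 w3 w4 := by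
  unfold C232P; rw [frakc1T_thetaIota, frakc2PT_thetaIota, C232T_thetaIota]

/-- **regression**: `C232D θ₀ = C232c`. [cite: Zhang2022LandauSiegel, (2.32) p.11] -/
theorem C232D_theta0 : C232D theta0 = C232c := by
  unfold C232D; rw [frakc1T_theta0, frakc2T_theta0, C232T_theta0_c]

/-- **regression**: `C232P θ₀ = C232`. [cite: Zhang2022LandauSiegel, (2.32) p.11] -/
theorem C232P_theta0 : C232P theta0 = C232 := by
  unfold C232P; rw [frakc1T_theta0, frakc2PT_theta0, C232T_theta0]

/-- **the one-functional margin specialises to the object of record**: `Margin232P θ₀ ↔ Skeleton.Margin232`.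
[cite: Zhang2022LandauSiegel, §18 p.99] -/
theorem margin232P_theta0_iff : Margin232P theta0 ↔ Skeleton.Margin232 := by
  unfold Margin232P; rw [frakc1T_theta0, frakc2PT_theta0]; exact margin232T_theta0_iff

/-- hence it FAILS at the printed design (the refutation of record, transported). [cite: Zhang2022LandauSiegel, §18 p.99] -/
theorem not_margin232P_theta0 : ¬ Margin232P theta0 := by
  rw [margin232P_theta0_iff]; exact Skeleton.not_margin232

/-- on the printed `ι`-family the reading of record stays `≥ 0.02491` (`Section18AllIota.C232cG_ge`, transported):
no `ι` repairs the printed exponents/shifts. [cite: Zhang2022LandauSiegel, (2.26) p.10, (2.32) p.11] -/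
theorem C232D_thetaIota_ge (w2 w3 w4 : ℂ) : (0.02491 : ℝ) ≤ C232D (thetaIota w2 w3 w4) := by
  rw [C232D_thetaIota]; exact C232cG_ge w2 w3 w4

/-- the same for the printed-prefactor reading: `≥ 0.03095`. [cite: Zhang2022LandauSiegel, (2.26) p.10, (2.32) p.11] -/
theorem C232P_thetaIota_ge (w2 w3 w4 : ℂ) : (0.03095 : ℝ) ≤ C232P (thetaIota w2 w3 w4) := by
  rw [C232P_thetaIota]; exact C232G_ge w2 w3 w4

end Repair

end Literature.NumberTheory.LFunctions.Zhang2022
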